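import Summits.AtomisticToContinuum.FouriersLaw.Theorems.PhononMeanFreePathIncoherentBoundedCorrelationDecay
import Summits.AtomisticToContinuum.FouriersLaw.Theorems.BondHeatUncertaintySubdiffusiveBondHeatSiteEnergyDynkinTruncation

/-!
# `PhononMeanFreePath.IncoherentBounded` — Dynkin's identity for the energy along the equilibrium kernels

Helper file for item `stmt-AtomisticToContinuum-11815` (support `IncoherentBounded`, route `PhononMeanFreePath`,
sub-problem `FouriersLaw`), part 1 of the ZEROTH-MOMENT SUM RULE (file `…IncoherentBoundedSumRule`). For the pinned
anharmonic chain `pinnedChain ω₂ lam β γ` (`ω₂, β, γ > 0`, `lam ≥ 0`) with `N ≥ 1` sites, equal bath temperatures `T > 0`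
and the CONSTRUCTED transition kernels `P_t = OscillatorChain.transitionKernel N T T t` (`LangevinChainKernel`):

* `pinnedChain_generator_hamiltonian` — `L H = γ ((T_L - p₀²) + (T_R - p²_{N-1}))` (only the baths act on the energy;
  for `N = 1` both baths sit on site `0`); `pinnedChain_abs_generator_hamiltonian_le` — `|LH| ≤ γ(2T+4)(1+H)²`;
* `pinnedChain_abs_generator_truncHamiltonian_sub_le` — the truncation error `|L(Hχ(H/R)) - χ(H/R) LH| ≤ (A/R)(1+H)²`
  (`generator_mul_smoothCutoff_hamiltonian`; `∂_{p_i} H = p_i`, `p_i² ≤ 2H`);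
* `pinnedChain_hamiltonian_dynkin` — **Dynkin's identity for the (polynomially growing) energy**:
  `P_r H(z) - H(z) = ∫₀ʳ P_s(LH)(z) ds` for all `r ≥ 0`, `z`, by the tree's truncation lemma
  `pinnedChain_dynkin_of_truncation` (dominated convergence through CEHR (3.4)), exactly as for the bath-site energy
  (`stub_siteEnergyDynkin`).

No definitions; nothing here closes an item.
-/

noncomputable section

open MeasureTheory ProbabilityTheory Filter Topology Set
open scoped NNReal ENNReal
open Literature.MathematicalPhysics.KineticTheory.HeatConduction
open Literature.MathematicalPhysics.KineticTheory Literature.Probability.Process OscillatorChain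
open Summit.AtomisticToContinuum.FouriersLaw.Theorems.SubdiffusiveBondHeat

namespace Summit.AtomisticToContinuum.FouriersLaw.Theorems.IncoherentBounded

/-! ## 1. Dynkin's identity for the energy along the equilibrium kernels -/

section DynkinH

variable {ω₂ lam β γ : ℝ}

/-- **The truncation error for the energy.** For the pinned chain (`ω₂, lam, β, γ ≥ 0`, `N ≥ 1`, equal bath
temperatures `T ≥ 0`) there is `A ≥ 0` with `|L(H χ(H/R)) - χ(H/R) LH| ≤ (A/R)(1 + H)²` on phase space for all
`R ≥ 1`: by `generator_mul_smoothCutoff_hamiltonian` the difference is `H Lχ_R + Γ(H, χ_R)`, where `∂_{p_i}H = p_i`,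
`|χ'|, |χ''|` are bounded and `p_i² ≤ 2H`. [folklore] -/
theorem pinnedChain_abs_generator_truncHamiltonian_sub_le (hω : 0 ≤ ω₂) (hl : 0 ≤ lam) (hβ : 0 ≤ β) (hγ : 0 ≤ γ)
    {N : ℕ} (hN : 0 < N) {T : ℝ} (hT : 0 ≤ T) :
    ∃ A : ℝ, 0 ≤ A ∧ ∀ R : ℝ, 1 ≤ R → ∀ x : PhaseSpace N,
      |(pinnedChain ω₂ lam β γ).generator N T T (fun y =>
            (pinnedChain ω₂ lam β γ).hamiltonian N y * smoothCutoff ((pinnedChain ω₂ lam β γ).hamiltonian N y / R)) x -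
          smoothCutoff ((pinnedChain ω₂ lam β γ).hamiltonian N x / R) *
            (pinnedChain ω₂ lam β γ).generator N T T ((pinnedChain ω₂ lam β γ).hamiltonian N) x| ≤
        A / R * (1 + (pinnedChain ω₂ lam β γ).hamiltonian N x) ^ 2 := by
  obtain ⟨M₁, hM₁0, hM₁⟩ := exists_bound_deriv_smoothCutoff
  obtain ⟨M₂, hM₂0, hM₂⟩ := exists_bound_deriv_deriv_smoothCutoff
  refine ⟨γ * (10 * M₁ * T + 4 * M₁ + 4 * M₂ * T), by positivity, fun R hR x => ?_⟩
  have hR0 : 0 < R := lt_of_lt_of_le one_pos hR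
  set P := pinnedChain ω₂ lam β γ with hP
  have hTγ : 0 ≤ P.γ * T := mul_nonneg hγ hT
  have hU2 : ContDiff ℝ 2 P.U := pinnedChain_contDiff_U ω₂ lam β γ
  have hV2 : ContDiff ℝ 2 P.V := pinnedChain_contDiff_V ω₂ lam β γ
  have hH2 : ContDiff ℝ 2 (P.hamiltonian N) := P.contDiff_hamiltonian hU2 hV2 N
  have hγ' : P.γ = γ := rfl
  rw [generator_mul_smoothCutoff_hamiltonian hU2 hV2 hN hTγ hTγ hH2 R x, P.partialP_hamiltonian,
    P.partialP_hamiltonian, hγ', add_sub_cancel_left]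
  -- the elementary bounds
  have hH0 : 0 ≤ P.hamiltonian N x := pinnedChain_hamiltonian_nonneg hω hl hβ γ N x
  have hU0 : ∀ q, 0 ≤ P.U q := fun q => by
    show 0 ≤ ω₂ * q ^ 2 / 2 + lam * q ^ 4 / 4; positivity
  have hV0 : ∀ r, 0 ≤ P.V r := fun r => by
    show 0 ≤ r ^ 2 / 2 + β * r ^ 4 / 4; positivity
  have haH : x.2 ⟨0, hN⟩ ^ 2 ≤ 2 * P.hamiltonian N x := by
    have h1 := P.site_le_hamiltonian hU0 hV0 N x ⟨0, hN⟩
    have h2 := hU0 (x.1 ⟨0, hN⟩)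
    linarith
  have hbH : x.2 ⟨N - 1, Nat.sub_lt hN one_pos⟩ ^ 2 ≤ 2 * P.hamiltonian N x := by
    have h1 := P.site_le_hamiltonian hU0 hV0 N x ⟨N - 1, Nat.sub_lt hN one_pos⟩
    have h2 := hU0 (x.1 ⟨N - 1, Nat.sub_lt hN one_pos⟩)
    linarith
  have hχ₁b := hM₁ (P.hamiltonian N x / R)
  have hχ₂b := hM₂ (P.hamiltonian N x / R)
  -- make the atoms opaque
  generalize deriv smoothCutoff (P.hamiltonian N x / R) = χ₁ at hχ₁b ⊢
  generalize deriv (deriv smoothCutoff) (P.hamiltonian N x / R) = χ₂ at hχ₂b ⊢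
  generalize P.hamiltonian N x = Hx at hH0 haH hbH ⊢
  generalize x.2 ⟨0, hN⟩ = p at haH ⊢
  generalize x.2 ⟨N - 1, Nat.sub_lt hN one_pos⟩ = q at hbH ⊢
  have ha0 : 0 ≤ p ^ 2 := sq_nonneg _
  have hb0 : 0 ≤ q ^ 2 := sq_nonneg _
  have key : Hx * (γ * (χ₁ / R * (T + T - p ^ 2 - q ^ 2) + χ₂ / R ^ 2 * (T * p ^ 2 + T * q ^ 2))) +
      χ₁ / R * (2 * γ * T * p * p + 2 * γ * T * q * q) =
      γ / R * (Hx * (χ₁ * (2 * T - p ^ 2 - q ^ 2) + χ₂ * T * (p ^ 2 + q ^ 2) / R) +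
        χ₁ * (2 * T * (p ^ 2 + q ^ 2))) := by
    field_simp; ring
  have hin : |Hx * (χ₁ * (2 * T - p ^ 2 - q ^ 2) + χ₂ * T * (p ^ 2 + q ^ 2) / R) +
        χ₁ * (2 * T * (p ^ 2 + q ^ 2))| ≤
      Hx * (M₁ * (2 * T + p ^ 2 + q ^ 2) + M₂ * T * (p ^ 2 + q ^ 2)) + M₁ * (2 * T * (p ^ 2 + q ^ 2)) := by
    have h1 : |χ₁ * (2 * T - p ^ 2 - q ^ 2)| ≤ M₁ * (2 * T + p ^ 2 + q ^ 2) := by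
      rw [abs_mul]
      refine mul_le_mul hχ₁b ?_ (abs_nonneg _) hM₁0
      rw [abs_le]; constructor <;> linarith
    have h2 : |χ₂ * T * (p ^ 2 + q ^ 2) / R| ≤ M₂ * T * (p ^ 2 + q ^ 2) := by
      rw [abs_div, abs_mul, abs_mul, abs_of_nonneg hT, abs_of_nonneg (add_nonneg ha0 hb0), abs_of_pos hR0]
      calc |χ₂| * T * (p ^ 2 + q ^ 2) / R ≤ |χ₂| * T * (p ^ 2 + q ^ 2) / 1 :=
            div_le_div_of_nonneg_left (by positivity) one_pos hR
        _ ≤ M₂ * T * (p ^ 2 + q ^ 2) := by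
            rw [div_one]
            exact mul_le_mul_of_nonneg_right (mul_le_mul_of_nonneg_right hχ₂b hT) (add_nonneg ha0 hb0)
    have h3 : |χ₁ * (2 * T * (p ^ 2 + q ^ 2))| ≤ M₁ * (2 * T * (p ^ 2 + q ^ 2)) := by
      rw [abs_mul, abs_of_nonneg (by positivity : (0:ℝ) ≤ 2 * T * (p ^ 2 + q ^ 2))]
      exact mul_le_mul_of_nonneg_right hχ₁b (by positivity)
    calc |Hx * (χ₁ * (2 * T - p ^ 2 - q ^ 2) + χ₂ * T * (p ^ 2 + q ^ 2) / R) + χ₁ * (2 * T * (p ^ 2 + q ^ 2))|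
        ≤ |Hx * (χ₁ * (2 * T - p ^ 2 - q ^ 2) + χ₂ * T * (p ^ 2 + q ^ 2) / R)| +
            |χ₁ * (2 * T * (p ^ 2 + q ^ 2))| := abs_add_le _ _
      _ = Hx * |χ₁ * (2 * T - p ^ 2 - q ^ 2) + χ₂ * T * (p ^ 2 + q ^ 2) / R| +
            |χ₁ * (2 * T * (p ^ 2 + q ^ 2))| := by rw [abs_mul, abs_of_nonneg hH0]
      _ ≤ Hx * (|χ₁ * (2 * T - p ^ 2 - q ^ 2)| + |χ₂ * T * (p ^ 2 + q ^ 2) / R|) +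
            |χ₁ * (2 * T * (p ^ 2 + q ^ 2))| := by
          gcongr
          exact abs_add_le _ _
      _ ≤ Hx * (M₁ * (2 * T + p ^ 2 + q ^ 2) + M₂ * T * (p ^ 2 + q ^ 2)) + M₁ * (2 * T * (p ^ 2 + q ^ 2)) := by
          gcongr
  have hpoly : Hx * (M₁ * (2 * T + p ^ 2 + q ^ 2) + M₂ * T * (p ^ 2 + q ^ 2)) + M₁ * (2 * T * (p ^ 2 + q ^ 2)) ≤
      (10 * M₁ * T + 4 * M₁ + 4 * M₂ * T) * (1 + Hx) ^ 2 := by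
    have s1 : Hx * (M₁ * (2 * T + p ^ 2 + q ^ 2) + M₂ * T * (p ^ 2 + q ^ 2)) ≤
        Hx * (M₁ * (2 * T + 4 * Hx) + M₂ * T * (4 * Hx)) := by
      refine mul_le_mul_of_nonneg_left ?_ hH0
      have := mul_nonneg hM₂0 hT
      nlinarith
    have s2 : M₁ * (2 * T * (p ^ 2 + q ^ 2)) ≤ M₁ * (2 * T * (4 * Hx)) :=
      mul_le_mul_of_nonneg_left (mul_le_mul_of_nonneg_left (by linarith) (by positivity)) hM₁0
    nlinarith [mul_nonneg hM₁0 hT, mul_nonneg (mul_nonneg hM₁0 hT) hH0, mul_nonneg hM₁0 hH0,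
      mul_nonneg (mul_nonneg hM₁0 hT) (sq_nonneg Hx), mul_nonneg hM₂0 hT,
      mul_nonneg (mul_nonneg hM₂0 hT) hH0, mul_nonneg hM₁0 (sq_nonneg Hx)]
  rw [key, abs_mul, abs_div, abs_of_nonneg hγ, abs_of_pos hR0]
  calc γ / R * |Hx * (χ₁ * (2 * T - p ^ 2 - q ^ 2) + χ₂ * T * (p ^ 2 + q ^ 2) / R) + χ₁ * (2 * T * (p ^ 2 + q ^ 2))|
      ≤ γ / R * (Hx * (M₁ * (2 * T + p ^ 2 + q ^ 2) + M₂ * T * (p ^ 2 + q ^ 2)) + M₁ * (2 * T * (p ^ 2 + q ^ 2))) :=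
        mul_le_mul_of_nonneg_left hin (div_nonneg hγ hR0.le)
    _ ≤ γ / R * ((10 * M₁ * T + 4 * M₁ + 4 * M₂ * T) * (1 + Hx) ^ 2) :=
        mul_le_mul_of_nonneg_left hpoly (div_nonneg hγ hR0.le)
    _ = γ * (10 * M₁ * T + 4 * M₁ + 4 * M₂ * T) / R * (1 + Hx) ^ 2 := by ring

/-- `L H = γ ((T_L - p₀²) + (T_R - p²_{N-1}))` for the pinned chain with `N ≥ 1` sites (for `N = 1` both baths sit on
site `0`). [cite: BonettoLebowitzReyBellet2000, §5.2 eq. (25)] -/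
theorem pinnedChain_generator_hamiltonian {N : ℕ} (hN : 0 < N) (T_L T_R : ℝ) (x : PhaseSpace N) :
    (pinnedChain ω₂ lam β γ).generator N T_L T_R ((pinnedChain ω₂ lam β γ).hamiltonian N) x =
      γ * ((T_L - x.2 ⟨0, hN⟩ ^ 2) + (T_R - x.2 ⟨N - 1, Nat.sub_lt hN one_pos⟩ ^ 2)) := by
  rw [generator_hamiltonian_eq (pinnedChain ω₂ lam β γ) N T_L T_R x, sum_bath_ite_eq hN]
  rfl

/-- `|L H| ≤ γ (2T + 4) (1 + H)²` at equal bath temperatures `T ≥ 0` (`p_i² ≤ 2H`). [folklore] -/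
theorem pinnedChain_abs_generator_hamiltonian_le (hω : 0 ≤ ω₂) (hl : 0 ≤ lam) (hβ : 0 ≤ β) (hγ : 0 ≤ γ)
    {N : ℕ} (hN : 0 < N) {T : ℝ} (hT : 0 ≤ T) (x : PhaseSpace N) :
    |(pinnedChain ω₂ lam β γ).generator N T T ((pinnedChain ω₂ lam β γ).hamiltonian N) x| ≤
      γ * (2 * T + 4) * (1 + (pinnedChain ω₂ lam β γ).hamiltonian N x) ^ 2 := by
  set P := pinnedChain ω₂ lam β γ with hP
  rw [pinnedChain_generator_hamiltonian hN]
  have hH0 : 0 ≤ P.hamiltonian N x := pinnedChain_hamiltonian_nonneg hω hl hβ γ N x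
  have hU0 : ∀ q, 0 ≤ P.U q := fun q => by
    show 0 ≤ ω₂ * q ^ 2 / 2 + lam * q ^ 4 / 4; positivity
  have hV0 : ∀ r, 0 ≤ P.V r := fun r => by
    show 0 ≤ r ^ 2 / 2 + β * r ^ 4 / 4; positivity
  have haH : x.2 ⟨0, hN⟩ ^ 2 ≤ 2 * P.hamiltonian N x := by
    have h1 := P.site_le_hamiltonian hU0 hV0 N x ⟨0, hN⟩
    have h2 := hU0 (x.1 ⟨0, hN⟩)
    linarith
  have hbH : x.2 ⟨N - 1, Nat.sub_lt hN one_pos⟩ ^ 2 ≤ 2 * P.hamiltonian N x := by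
    have h1 := P.site_le_hamiltonian hU0 hV0 N x ⟨N - 1, Nat.sub_lt hN one_pos⟩
    have h2 := hU0 (x.1 ⟨N - 1, Nat.sub_lt hN one_pos⟩)
    linarith
  generalize P.hamiltonian N x = Hx at hH0 haH hbH ⊢
  generalize x.2 ⟨0, hN⟩ = p at haH ⊢
  generalize x.2 ⟨N - 1, Nat.sub_lt hN one_pos⟩ = q at hbH ⊢
  rw [abs_mul, abs_of_nonneg hγ, mul_assoc]
  refine mul_le_mul_of_nonneg_left ?_ hγ
  have h1 : |(T - p ^ 2) + (T - q ^ 2)| ≤ 2 * T + 4 * Hx := by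
    rw [abs_le]; constructor <;> nlinarith [sq_nonneg p, sq_nonneg q]
  calc |(T - p ^ 2) + (T - q ^ 2)| ≤ 2 * T + 4 * Hx := h1
    _ ≤ (2 * T + 4) * (1 + Hx) ^ 2 := by nlinarith [mul_nonneg hT hH0, sq_nonneg Hx, mul_nonneg hT (sq_nonneg Hx)]

/-- **Dynkin's identity for the energy of the pinned anharmonic chain.** For `pinnedChain ω₂ lam β γ`
(`ω₂, β, γ > 0`, `lam ≥ 0`), `N ≥ 1`, equal bath temperatures `T > 0` and the constructed transition kernels
`P_t = OscillatorChain.transitionKernel N T T t`: `P_r H(z) - H(z) = ∫₀ʳ P_s(L H)(z) ds` for all `r ≥ 0`, `z` — Dynkin's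
formula for the polynomially bounded observable `H` (`L H = γ(T - p₀²) + γ(T - p²_{N-1})`), from the `C²_c` case by the
truncations `H χ(H/R)` (`pinnedChain_dynkin_of_truncation`, `pinnedChain_abs_generator_truncHamiltonian_sub_le`), the
error terms being `O((1 + H)²/R) = O(e^{H/(2T)}/R)` and the kernels integrating `e^{H/(2T)}` (CEHR (3.4)).
[cite: CuneoEckmannHairerReyBellet2018, §3 eq. (3.2)–(3.4)] -/
theorem pinnedChain_hamiltonian_dynkin (hω : 0 < ω₂) (hl : 0 ≤ lam) (hβ : 0 < β) (hγ : 0 < γ) {N : ℕ} (hN : 0 < N)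
    {T : ℝ} (hT : 0 < T) (r : ℝ≥0) (z : PhaseSpace N) :
    ∫ y, (pinnedChain ω₂ lam β γ).hamiltonian N y ∂((pinnedChain ω₂ lam β γ).transitionKernel N T T r z) -
        (pinnedChain ω₂ lam β γ).hamiltonian N z =
      ∫ s in (0 : ℝ)..(r : ℝ), ∫ y, (pinnedChain ω₂ lam β γ).generator N T T ((pinnedChain ω₂ lam β γ).hamiltonian N) y
        ∂((pinnedChain ω₂ lam β γ).transitionKernel N T T s.toNNReal z) := by
  -- the constants
  obtain ⟨A, hA0, hA⟩ := pinnedChain_abs_generator_truncHamiltonian_sub_le (γ := γ) hω.le hl hβ.le hγ.le hN hT.le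
  set θ : ℝ := 1 / (2 * T) with hθ
  have hθ0 : 0 < θ := by positivity
  have hθ1 : θ < 1 / T := by
    rw [hθ, div_lt_div_iff₀ (by positivity) hT]; nlinarith
  set B : ℝ := γ * (2 * T + 4) with hB
  have hB0 : 0 ≤ B := by positivity
  set C₀ : ℝ := 2 * Real.exp θ / θ ^ 2 with hC₀
  have hC₀0 : 0 ≤ C₀ := by positivity
  -- the observable, its generator image, the truncations
  set e : PhaseSpace N → ℝ := (pinnedChain ω₂ lam β γ).hamiltonian N with he
  set ℓ : PhaseSpace N → ℝ := fun y => (pinnedChain ω₂ lam β γ).generator N T T e y with hℓ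
  set f : ℕ → PhaseSpace N → ℝ := fun n y => e y * smoothCutoff (e y / (n + 1)) with hf
  have hfdef : ∀ n y, f n y = e y * smoothCutoff (e y / (n + 1)) := fun n y => rfl
  -- regularity and compact support
  have hU2 : ContDiff ℝ 2 (pinnedChain ω₂ lam β γ).U := pinnedChain_contDiff_U ω₂ lam β γ
  have hV2 : ContDiff ℝ 2 (pinnedChain ω₂ lam β γ).V := pinnedChain_contDiff_V ω₂ lam β γ
  have he2 : ContDiff ℝ 2 e := (pinnedChain ω₂ lam β γ).contDiff_hamiltonian hU2 hV2 N
  have hH0 : ∀ y, 0 ≤ e y := fun y => pinnedChain_hamiltonian_nonneg hω.le hl hβ.le γ N y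
  have hRpos : ∀ n : ℕ, (0:ℝ) < n + 1 := fun n => by positivity
  have hR1 : ∀ n : ℕ, (1:ℝ) ≤ n + 1 := fun n => by
    have : (0:ℝ) ≤ n := Nat.cast_nonneg n
    linarith
  have hf2 : ∀ n, ContDiff ℝ 2 (f n) := fun n =>
    he2.mul ((contDiff_smoothCutoff (n := 2)).comp (he2.div_const _))
  have hfs : ∀ n, HasCompactSupport (f n) := fun n => by
    refine HasCompactSupport.intro
      (pinnedChain_isCompact_setOf_hamiltonian_le hω hl hβ.le γ N (2 * (n + 1))) fun y hy => ?_
    simp only [mem_setOf_eq, not_le] at hy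
    have h2 : 2 ≤ e y / (n + 1) := by
      rw [le_div_iff₀ (hRpos n)]; rw [he]; linarith
    rw [hfdef, smoothCutoff_of_two_le h2, mul_zero]
  -- eventually the cutoff is `1`
  have hev : ∀ y, ∀ᶠ n : ℕ in atTop, smoothCutoff (e y / (n + 1)) = 1 := by
    intro y
    obtain ⟨n₀, hn₀⟩ := exists_nat_ge (e y)
    filter_upwards [eventually_ge_atTop n₀] with n hn
    have h1 : e y / (n + 1) ≤ 1 := by
      rw [div_le_one (hRpos n)]
      have : (n₀ : ℝ) ≤ n := by exact_mod_cast hn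
      linarith
    exact smoothCutoff_of_le_one h1
  -- size estimates
  have hsq : ∀ y, (1 + e y) ^ 2 ≤ C₀ * Real.exp (θ * e y) := fun y => one_add_sq_le_exp (hH0 y) hθ0
  have hℓb : ∀ y, |ℓ y| ≤ B * (1 + e y) ^ 2 := fun y =>
    pinnedChain_abs_generator_hamiltonian_le hω.le hl hβ.le hγ.le hN hT.le y
  -- the truncation error, with `Le = ℓ`
  have herr : ∀ (n : ℕ) (y : PhaseSpace N),
      |(pinnedChain ω₂ lam β γ).generator N T T (f n) y - smoothCutoff (e y / (n + 1)) * ℓ y| ≤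
        A / (n + 1) * (1 + e y) ^ 2 := fun n y => hA (n + 1) (hR1 n) y
  -- the uniform exponential domination of `f_n` and `L f_n`
  have hfb : ∀ (n : ℕ) (y : PhaseSpace N), |f n y| ≤ (A + B + 1) * C₀ * Real.exp (θ * e y) := by
    intro n y
    have h0 := hH0 y
    have hχ0 := smoothCutoff_nonneg (e y / (n + 1))
    have hχ1 := smoothCutoff_le_one (e y / (n + 1))
    have hs := hsq y
    rw [hfdef, abs_of_nonneg (mul_nonneg h0 hχ0)]
    generalize e y = Hy at h0 hs hχ0 hχ1 ⊢
    generalize smoothCutoff (Hy / (n + 1)) = c at hχ0 hχ1 ⊢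
    calc Hy * c ≤ Hy := mul_le_of_le_one_right h0 hχ1
      _ ≤ 1 * (1 + Hy) ^ 2 := by nlinarith
      _ ≤ (A + B + 1) * (1 + Hy) ^ 2 := by gcongr; linarith
      _ ≤ (A + B + 1) * (C₀ * Real.exp (θ * Hy)) := by gcongr
      _ = (A + B + 1) * C₀ * Real.exp (θ * Hy) := by ring
  have hLb : ∀ (n : ℕ) (y : PhaseSpace N), |(pinnedChain ω₂ lam β γ).generator N T T (f n) y| ≤
      (A + B + 1) * C₀ * Real.exp (θ * e y) := by
    intro n y
    have h1 := herr n y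
    have h2 := hℓb y
    have hs := hsq y
    have hHy := hH0 y
    have hχ0 := smoothCutoff_nonneg (e y / (n + 1))
    have hχ1 := smoothCutoff_le_one (e y / (n + 1))
    generalize (pinnedChain ω₂ lam β γ).generator N T T (f n) y = G at h1 ⊢
    generalize e y = Hy at h1 h2 hs hHy hχ0 hχ1 ⊢
    generalize smoothCutoff (Hy / (n + 1)) = c at hχ0 hχ1 h1 ⊢
    generalize ℓ y = l at h1 h2 ⊢
    have h3 : |c * l| ≤ B * (1 + Hy) ^ 2 := by
      rw [abs_mul, abs_of_nonneg hχ0]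
      calc c * |l| ≤ 1 * |l| := mul_le_mul_of_nonneg_right hχ1 (abs_nonneg _)
        _ ≤ B * (1 + Hy) ^ 2 := by rw [one_mul]; exact h2
    have h4 : A / (n + 1) * (1 + Hy) ^ 2 ≤ A * (1 + Hy) ^ 2 :=
      mul_le_mul_of_nonneg_right (div_le_self hA0 (hR1 n)) (sq_nonneg _)
    calc |G| ≤ |G - c * l| + |c * l| := by
          have := abs_add_le (G - c * l) (c * l); rwa [sub_add_cancel] at this
      _ ≤ A * (1 + Hy) ^ 2 + B * (1 + Hy) ^ 2 := add_le_add (h1.trans h4) h3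
      _ ≤ (A + B + 1) * (1 + Hy) ^ 2 := by nlinarith [sq_nonneg (1 + Hy)]
      _ ≤ (A + B + 1) * (C₀ * Real.exp (θ * Hy)) := by gcongr
      _ = (A + B + 1) * C₀ * Real.exp (θ * Hy) := by ring
  -- pointwise convergence of `f_n` and `L f_n`
  have hfe : ∀ y, Tendsto (fun n => f n y) atTop (𝓝 (e y)) := fun y => by
    refine tendsto_const_nhds.congr' ?_
    filter_upwards [hev y] with n hn
    rw [hfdef, hn, mul_one]
  have hfℓ : ∀ y, Tendsto (fun n => (pinnedChain ω₂ lam β γ).generator N T T (f n) y) atTop (𝓝 (ℓ y)) := by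
    intro y
    have hg : Tendsto (fun n : ℕ => smoothCutoff (e y / (n + 1)) * ℓ y) atTop (𝓝 (ℓ y)) := by
      refine tendsto_const_nhds.congr' ?_
      filter_upwards [hev y] with n hn
      rw [hn, one_mul]
    have hd : Tendsto (fun n : ℕ => (pinnedChain ω₂ lam β γ).generator N T T (f n) y -
        smoothCutoff (e y / (n + 1)) * ℓ y) atTop (𝓝 0) := by
      have hCn : Tendsto (fun n : ℕ => A / (n + 1) * (1 + e y) ^ 2) atTop (𝓝 0) := by
        have h1 : Tendsto (fun n : ℕ => A / ((n : ℝ) + 1)) atTop (𝓝 0) :=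
          tendsto_const_nhds.div_atTop (tendsto_natCast_atTop_atTop.atTop_add tendsto_const_nhds)
        simpa using h1.mul_const ((1 + e y) ^ 2)
      exact squeeze_zero_norm (fun n => by rw [Real.norm_eq_abs]; exact herr n y) hCn
    have := hd.add hg
    simpa using this
  exact pinnedChain_dynkin_of_truncation hω hl hβ hγ hN hT hθ0 hθ1 f hf2 hfs hfe hfℓ hfb hLb r z

end DynkinH

end Summit.AtomisticToContinuum.FouriersLaw.Theorems.IncoherentBounded

end
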